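import Literature.Analysis.FluidPDE.PutativeSelfSimilarEuler
import Literature.Analysis.FluidPDE.NSVorticityBKMHolds
import Literature.Analysis.FluidPDE.NSVorticityBKMEnergy
import Literature.Analysis.FluidPDE.VorticityCalculus
import HarnessLib

/-!
# Constantin–Ignatova–Vicol 2026, Theorem 2.1 (`γ ≥ 2/5`), discharged

Analysis/FluidPDE proof file (theorems only, no definitions, no named facts): the named fact
`Literature.Analysis.FluidPDE.CIV2026_collapseExponent_ge_two_fifths` of
`PutativeSelfSimilarEuler.lean` — P. Constantin, M. Ignatova, V. Vicol, *On putative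
self-similarity for incompressible 3D Euler*, arXiv:2602.17570, §2, Theorem 2.1 (p. 5): a
finite-energy classical Euler solution on `[0, T)` in the Beale–Kato–Majda class which does not
continue in the class past `T` and satisfies `sup_t (T − t)^{1+γ} ‖∇ω(t)‖_{L^∞} < ∞`, `γ > 0`,
has `γ ≥ 2/5` — is now a theorem, `CIV2026_collapseExponent_ge_two_fifths_holds`.

## The proof

The printed proof (arXiv:2602.17570, pp. 5–6) bounds the vortex-stretching factor `α` by the
two-scale estimate `|α| ≤ C (R ‖∇ω‖_∞ + R^{-5/2} ‖u‖_{L²})` (inner part by `∇ω`, outer part by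
the conserved kinetic energy after integrating the curl by parts), optimises
`R = R(t)` to get `|α| ≲ (T − t)^{-5(1+γ)/7}`, which is time-integrable iff `γ < 2/5`, and
concludes by the transport of `|ω|` and the Beale–Kato–Majda criterion. Here the last step is the
tree's discharged criterion `beale_kato_majda_holds` (`NSVorticityBKMHolds.lean`), which only asks
for `∫₀ᵀ ‖ω(t)‖_{L^∞} dt < ∞`; we therefore apply the *same two-scale estimate directly to `ω`*
(a genuinely shorter road with the same exponents, no singular integral and no Lagrangian flow):
for `ω = curl v`, pairing `ω` with the cutoff `χ_R(· − x)` (tree `cutoff`, `‖Dχ_R‖ ≤ C/R`) and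
integrating the curl by parts (tree `integral_mul_inner_curl_eq`),
`‖ω(x)‖² ∫χ = ∫ ⟪v, ∇χ × ω(x)⟫ − ∫ χ ⟪ω(y) − ω(x), ω(x)⟫`, whence
`‖ω(x)‖ ≤ 2R ‖∇ω‖_∞ + K (E + 1) R^{-5/2}` with `E ≥ ∫|v|²`
(`CIV2026.norm_curl_le_two_scale`). With `‖∇ω(t)‖_∞ ≤ M (T − t)^{-(1+γ)}` (the hypothesis),
`∫|u(t)|² ≤ ∫|u(0)|²` (the energy inequality in the BKM class, tree
`IsClassicalNSSolutionOn.bkm_energy_le`) and `R = (T − t)^{2(1+γ)/7}` this is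
`‖ω(t)‖_∞ ≤ K' (T − t)^{-5(1+γ)/7}`, integrable on `(0, T)` when `γ < 2/5`
(`CIV2026.lintegral_Ioo_rpow_neg_lt_top`), so `beale_kato_majda_holds` continues the solution in
the class past `T`, contradicting the blow-up hypothesis.

## Mathlib / tree search

Tree (all used): `beale_kato_majda_holds` (`NSVorticityBKMHolds`),
`IsClassicalNSSolutionOn.bkm_energy_le` (`NSVorticityBKMEnergy`),
`levelSq_bounds_of_hasBoundedSobolevNormsOn` (`NSVorticityBKMTools`), `integral_mul_inner_curl_eq`,
`contDiff_curl`, `continuous_curl`, `curl_eq_zero_of_fderiv_eq_zero`, `norm_curlCLM_smulRight_le`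
(`VorticityCalculus`), `cutoff`, `cutoff_eq_one`, `cutoff_eq_zero`, `exists_norm_fderiv_cutoff_le`
(`WholeSpaceIBP`). Mathlib: `Convex.norm_image_sub_le_of_norm_fderiv_le`,
`Measure.addHaar_real_closedBall'`, `integral_indicator_one`, `norm_integral_le_of_norm_le`,
`intervalIntegral.intervalIntegrable_rpow'`, `IntervalIntegrable.comp_sub_left`,
`Integrable.lintegral_lt_top`, `setLIntegral_mono'`. No `…two_fifths_holds` existed
(`lean search 'two_fifths|CIV2026'`).

## References

* P. Constantin, M. Ignatova, V. Vicol, *On putative self-similarity for incompressible 3D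
  Euler*, arXiv:2602.17570 (2026), §2, Theorem 2.1 and its proof (pp. 5–6).
  [ConstantinIgnatovaVicol2026Putative]
* J. T. Beale, T. Kato, A. Majda, Comm. Math. Phys. 94 (1984), 61–66, Theorem 1.
  [BealeKatoMajda1984]
-/

noncomputable section

open MeasureTheory Set Function Filter Metric
open _root_.Topology
open scoped ENNReal NNReal RealInnerProductSpace

namespace Literature.Analysis.FluidPDE

namespace CIV2026

/-! ## The two-scale interpolation bound for `ω = curl v` -/

/-- AM–GM with an indicator weight: `a · 1_B ≤ (s/2) a² + 1_B/(2s)` for `a ≥ 0`, `s > 0`,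
`1_B ∈ {0, 1}` (any real `a`). [folklore] -/
theorem mul_indicator_le_amgm {a s i : ℝ} (hs : 0 < s) (hi : i = 0 ∨ i = 1) :
    a * i ≤ s / 2 * a ^ 2 + 1 / (2 * s) * i := by
  rcases hi with rfl | rfl
  · simp only [mul_zero, add_zero]
    positivity
  · have key : s / 2 * a ^ 2 + 1 / (2 * s) * 1 - a * 1 = 1 / (2 * s) * (s * a - 1) ^ 2 := by
      field_simp
      ring
    have h0 : 0 ≤ 1 / (2 * s) * (s * a - 1) ^ 2 := by positivity
    linarith

/-- `(Q²)^{-5/2} = Q⁻⁵` for `Q > 0`. [folklore] -/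
theorem sq_rpow_neg_five_halves {Q : ℝ} (hQ : 0 < Q) :
    (Q ^ 2) ^ (-(5 / 2 : ℝ)) = (Q ^ 5)⁻¹ := by
  rw [← Real.rpow_natCast Q 2, ← Real.rpow_mul hQ.le,
    show ((2 : ℕ) : ℝ) * (-(5 / 2 : ℝ)) = -((5 : ℕ) : ℝ) by norm_num, Real.rpow_neg hQ.le,
    Real.rpow_natCast]

/-- **Two-scale interpolation for the vorticity.** For `v ∈ C²(ℝ³; ℝ³)` with `∫|v|² ≤ E` and
`‖∇(curl v)‖ ≤ D` everywhere, and every `R > 0`: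
`‖curl v (x)‖ ≤ 2 R D + ‖curlCLM‖ C (E/(2V₁) + 4) R^{-5/2}`, where `C` is the gradient constant of
the tree's cutoff (`‖Dχ_R‖ ≤ C/R`) and `V₁ = |B̄(0,1)|`. Proof: pair `curl v` with
`χ_R(· − x) ω(x)`,
`ω(x) = curl v (x)`; the curl falls on the weight (`integral_mul_inner_curl_eq`,
`|∫⟪v, ∇χ × ω(x)⟫| ≤ ‖curlCLM‖ (C/R) ‖ω(x)‖ ∫_{B̄(x,2R)} |v|`), the oscillation of `curl v` on
`B̄(x, 2R)` is `≤ 2RD` (mean value inequality), `∫χ ≥ |B̄(x,R)| = R³V₁`, and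
`∫_{B̄(x,2R)}|v| ≤ (s/2) E + |B̄(x,2R)|/(2s)` with `s = R^{3/2}`. This is the two-scale estimate
of Constantin–Ignatova–Vicol (arXiv:2602.17570, (2.5)–(2.6)) applied to `ω` instead of the
stretching factor `α`. [folklore] -/
theorem norm_curl_le_two_scale {v : EuclideanSpace ℝ (Fin 3) → EuclideanSpace ℝ (Fin 3)}
    (hv : ContDiff ℝ 2 v) {D E R C : ℝ}
    (hD : ∀ y, ‖fderiv ℝ (curl v) y‖ ≤ D) (hvi : Integrable fun y => ‖v y‖ ^ 2)
    (hE : ∫ y, ‖v y‖ ^ 2 ≤ E) (hR : 0 < R)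
    (hC : ∀ y : EuclideanSpace ℝ (Fin 3),
      ‖fderiv ℝ (cutoff (E := EuclideanSpace ℝ (Fin 3)) R) y‖ ≤ C / R)
    (x : EuclideanSpace ℝ (Fin 3)) :
    ‖curl v x‖ ≤ 2 * R * D +
      ‖curlCLM‖ * C * (E / (2 * volume.real (closedBall (0 : EuclideanSpace ℝ (Fin 3)) 1)) + 4) *
        R ^ (-(5 / 2 : ℝ)) := by
  -- write `R = Q²`, so that every power below is integral
  obtain ⟨Q, hQ, hQR⟩ : ∃ Q : ℝ, 0 < Q ∧ R = Q ^ 2 :=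
    ⟨Real.sqrt R, Real.sqrt_pos.2 hR, (Real.sq_sqrt hR.le).symm⟩
  subst hQR
  rw [sq_rpow_neg_five_halves hQ]
  -- basic constants
  set a : EuclideanSpace ℝ (Fin 3) := curl v x with ha_def
  set V₁ : ℝ := volume.real (closedBall (0 : EuclideanSpace ℝ (Fin 3)) 1) with hV₁
  have hP0 : 0 ≤ ‖curlCLM‖ := norm_nonneg curlCLM
  have hD0 : 0 ≤ D := (norm_nonneg _).trans (hD x)
  have hE0 : 0 ≤ E := (integral_nonneg fun y => sq_nonneg _).trans hE
  have hC0 : 0 ≤ C := by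
    by_contra h
    push Not at h
    have h1 := (norm_nonneg _).trans (hC 0)
    have h2 : C / Q ^ 2 < 0 := div_neg_of_neg_of_pos h hR
    linarith
  have hV₁pos : 0 < V₁ := by
    rw [hV₁, measureReal_def]
    exact ENNReal.toReal_pos (measure_closedBall_pos volume _ one_pos).ne'
      measure_closedBall_lt_top.ne
  have h3 : Module.finrank ℝ (EuclideanSpace ℝ (Fin 3)) = 3 := finrank_euclideanSpace_fin
  -- regularity of `v` and `curl v`
  have hv1 : ContDiff ℝ 1 v := hv.of_le (by norm_cast)
  have hω1 : ContDiff ℝ 1 (curl v) := contDiff_curl (n := 1) (by exact_mod_cast hv)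
  have hωd : ∀ y ∈ (univ : Set (EuclideanSpace ℝ (Fin 3))), DifferentiableAt ℝ (curl v) y :=
    fun y _ => hω1.differentiable one_ne_zero y
  have hosc : ∀ y, ‖curl v y - a‖ ≤ D * ‖y - x‖ := fun y =>
    convex_univ.norm_image_sub_le_of_norm_fderiv_le hωd (fun y _ => hD y) (mem_univ x)
      (mem_univ y)
  -- the weight `φ = χ_R(· - x)`
  set φ : EuclideanSpace ℝ (Fin 3) → ℝ := fun y => cutoff (Q ^ 2) (y - x) with hφ_def
  have hφ1 : ContDiff ℝ 1 φ :=
    (contDiff_cutoff (n := 1) (Q ^ 2)).comp (contDiff_id.sub contDiff_const)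
  have hφcont : Continuous φ := hφ1.continuous
  have hφ0 : ∀ y, 0 ≤ φ y := fun y => cutoff_nonneg _ _
  have hφle : ∀ y, φ y ≤ 1 := fun y => cutoff_le_one _ _
  have hφone : ∀ y ∈ closedBall x (Q ^ 2), φ y = 1 := fun y hy => by
    rw [mem_closedBall, dist_eq_norm] at hy
    exact cutoff_eq_one hR hy
  have hφzero : ∀ y, y ∉ closedBall x (2 * Q ^ 2) → φ y = 0 := fun y hy => by
    rw [mem_closedBall, dist_eq_norm, not_le] at hy
    exact cutoff_eq_zero hR hy.le
  have hφc : HasCompactSupport φ :=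
    HasCompactSupport.intro (isCompact_closedBall x (2 * Q ^ 2)) hφzero
  have htsupp : tsupport φ ⊆ closedBall x (2 * Q ^ 2) :=
    closure_minimal (fun y hy => by_contra fun h => hy (hφzero y h)) isClosed_closedBall
  set B : Set (EuclideanSpace ℝ (Fin 3)) := closedBall x (2 * Q ^ 2) with hB_def
  have hBm : MeasurableSet B := measurableSet_closedBall
  have hDφ : ∀ y, ‖fderiv ℝ φ y‖ ≤ C / Q ^ 2 * B.indicator 1 y := fun y => by
    by_cases hy : y ∈ B
    · rw [indicator_of_mem hy, Pi.one_apply, mul_one, hφ_def, fderiv_comp_sub]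
      exact hC _
    · rw [indicator_of_notMem hy, mul_zero,
        fderiv_of_notMem_tsupport ℝ (fun h => hy (htsupp h)), norm_zero]
  have hind01 : ∀ y, B.indicator (1 : EuclideanSpace ℝ (Fin 3) → ℝ) y = 0 ∨
      B.indicator (1 : EuclideanSpace ℝ (Fin 3) → ℝ) y = 1 := fun y => by
    by_cases hy : y ∈ B
    · exact Or.inr (by rw [indicator_of_mem hy, Pi.one_apply])
    · exact Or.inl (indicator_of_notMem hy _)
  -- volumes
  have hVB : volume.real B = 8 * Q ^ 6 * V₁ := by
    rw [hB_def, Measure.addHaar_real_closedBall' volume x (by positivity), h3, hV₁]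
    ring
  have hVR : volume.real (closedBall x (Q ^ 2)) = Q ^ 6 * V₁ := by
    rw [Measure.addHaar_real_closedBall' volume x (by positivity), h3, hV₁]
    ring
  have hBint : Integrable (B.indicator (1 : EuclideanSpace ℝ (Fin 3) → ℝ)) :=
    (integrable_indicator_iff hBm).2 (integrableOn_const measure_closedBall_lt_top.ne)
  have hφint : Integrable φ := hφcont.integrable_of_hasCompactSupport hφc
  -- `I = ∫ φ ≥ |B̄(x, R)| = Q⁶ V₁ > 0`
  set I : ℝ := ∫ y, φ y with hI_def
  have hIge : Q ^ 6 * V₁ ≤ I := by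
    rw [← hVR, ← integral_indicator_one (μ := volume) measurableSet_closedBall, hI_def]
    refine integral_mono ((integrable_indicator_iff measurableSet_closedBall).2
      (integrableOn_const measure_closedBall_lt_top.ne)) hφint fun y => ?_
    by_cases hy : y ∈ closedBall x (Q ^ 2)
    · rw [indicator_of_mem hy, Pi.one_apply, hφone y hy]
    · rw [indicator_of_notMem hy]
      exact hφ0 y
  have hIpos : 0 < I := lt_of_lt_of_le (by positivity) hIge
  -- integration by parts: `∫ φ ⟪curl v, a⟫ = ∫ ⟪v, curlCLM (Dφ ⊗ a)⟫`
  have hibp := integral_mul_inner_curl_eq (F := v) (W := fun _ => a) hv1 contDiff_const hφ1 hφc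
  have hc0 : ∀ y, curl (fun _ : EuclideanSpace ℝ (Fin 3) => a) y = 0 := fun y =>
    curl_eq_zero_of_fderiv_eq_zero (hasFDerivAt_const a y).fderiv
  simp only [hc0, inner_zero_right, mul_zero, integral_zero, zero_add] at hibp
  -- splitting `⟪curl v y, a⟫ = ⟪curl v y - a, a⟫ + ‖a‖²`
  have hωc : Continuous (curl v) := continuous_curl hv1
  have i3 : Integrable fun y => φ y * ⟪curl v y - a, a⟫ :=
    (hφcont.mul
      ((hωc.sub continuous_const).inner continuous_const)).integrable_of_hasCompactSupport
      hφc.mul_right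
  have i4 : Integrable fun y => φ y * ‖a‖ ^ 2 := hφint.mul_const _
  have hsplit : ∫ y, φ y * ⟪curl v y, a⟫ = (∫ y, φ y * ⟪curl v y - a, a⟫) + I * ‖a‖ ^ 2 := by
    rw [hI_def, ← integral_mul_const, ← integral_add i3 i4]
    refine integral_congr_ae (Eventually.of_forall fun y => ?_)
    simp only
    rw [inner_sub_left, real_inner_self_eq_norm_sq]
    ring
  -- the oscillation term
  have hJ₃ : ‖∫ y, φ y * ⟪curl v y - a, a⟫‖ ≤ I * (2 * Q ^ 2 * D * ‖a‖) := by
    rw [hI_def, ← integral_mul_const]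
    refine norm_integral_le_of_norm_le (hφint.mul_const _) (Eventually.of_forall fun y => ?_)
    rw [norm_mul, Real.norm_of_nonneg (hφ0 y)]
    by_cases hy : y ∈ B
    · rw [hB_def, mem_closedBall, dist_eq_norm] at hy
      have h1 : ‖curl v y - a‖ ≤ 2 * Q ^ 2 * D :=
        (hosc y).trans (by nlinarith [norm_nonneg (y - x)])
      have h2 : ‖curl v y - a‖ * ‖a‖ ≤ 2 * Q ^ 2 * D * ‖a‖ :=
        mul_le_mul_of_nonneg_right h1 (norm_nonneg _)
      exact (mul_le_mul_of_nonneg_left (norm_inner_le_norm _ _) (hφ0 y)).trans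
        (mul_le_mul_of_nonneg_left h2 (hφ0 y))
    · rw [hφzero y hy, zero_mul, zero_mul]
  -- the far-field term, through the energy
  have hJ₂ : ‖∫ y, ⟪v y, curlCLM ((fderiv ℝ φ y).smulRight a)⟫‖ ≤
      ‖curlCLM‖ * ‖a‖ * (C / Q ^ 2) * (Q ^ 3 / 2 * E + 1 / (2 * Q ^ 3) * (8 * Q ^ 6 * V₁)) := by
    have hg : Integrable fun y =>
        ‖curlCLM‖ * ‖a‖ * (C / Q ^ 2) *
          (Q ^ 3 / 2 * ‖v y‖ ^ 2 + 1 / (2 * Q ^ 3) * B.indicator 1 y) :=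
      ((hvi.const_mul _).add (hBint.const_mul _)).const_mul _
    refine (norm_integral_le_of_norm_le hg (Eventually.of_forall fun y => ?_)).trans ?_
    · have h1 : ‖⟪v y, curlCLM ((fderiv ℝ φ y).smulRight a)⟫‖ ≤
          ‖v y‖ * (‖curlCLM‖ * (C / Q ^ 2 * B.indicator 1 y * ‖a‖)) := by
        refine (norm_inner_le_norm _ _).trans (mul_le_mul_of_nonneg_left ?_ (norm_nonneg _))
        refine (norm_curlCLM_smulRight_le _ _).trans ?_
        exact mul_le_mul_of_nonneg_left (mul_le_mul_of_nonneg_right (hDφ y) (norm_nonneg _)) hP0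
      have h2 : ‖v y‖ * B.indicator 1 y ≤
          Q ^ 3 / 2 * ‖v y‖ ^ 2 + 1 / (2 * Q ^ 3) * B.indicator 1 y :=
        mul_indicator_le_amgm (by positivity) (hind01 y)
      have h3' : 0 ≤ ‖curlCLM‖ * ‖a‖ * (C / Q ^ 2) := by positivity
      calc ‖⟪v y, curlCLM ((fderiv ℝ φ y).smulRight a)⟫‖
          ≤ ‖v y‖ * (‖curlCLM‖ * (C / Q ^ 2 * B.indicator 1 y * ‖a‖)) := h1
        _ = ‖curlCLM‖ * ‖a‖ * (C / Q ^ 2) * (‖v y‖ * B.indicator 1 y) := by ring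
        _ ≤ ‖curlCLM‖ * ‖a‖ * (C / Q ^ 2) *
            (Q ^ 3 / 2 * ‖v y‖ ^ 2 + 1 / (2 * Q ^ 3) * B.indicator 1 y) :=
          mul_le_mul_of_nonneg_left h2 h3'
    · rw [integral_const_mul, integral_add (hvi.const_mul _) (hBint.const_mul _),
        integral_const_mul, integral_const_mul, integral_indicator_one hBm, hVB]
      have h3' : 0 ≤ ‖curlCLM‖ * ‖a‖ * (C / Q ^ 2) := by positivity
      refine mul_le_mul_of_nonneg_left ?_ h3'
      gcongr
  -- assembling: `I ‖a‖² ≤ G₂ + G₃`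
  set G₂ : ℝ := ‖curlCLM‖ * ‖a‖ * (C / Q ^ 2) *
    (Q ^ 3 / 2 * E + 1 / (2 * Q ^ 3) * (8 * Q ^ 6 * V₁)) with hG₂
  have hmain : I * ‖a‖ ^ 2 ≤ G₂ + I * (2 * Q ^ 2 * D * ‖a‖) := by
    have e : I * ‖a‖ ^ 2 = (∫ y, ⟪v y, curlCLM ((fderiv ℝ φ y).smulRight a)⟫) -
        ∫ y, φ y * ⟪curl v y - a, a⟫ := by linarith [hibp, hsplit]
    rw [e]
    have h1 := (le_abs_self _).trans (Real.norm_eq_abs _ ▸ hJ₂)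
    have h2 := (neg_le_abs _).trans (Real.norm_eq_abs _ ▸ hJ₃)
    linarith
  -- the case `a = 0` is trivial
  rcases (norm_nonneg a).eq_or_lt with ha0 | ha0
  · rw [← ha0]
    positivity
  -- divide by `‖a‖ > 0` and by `I ≥ Q⁶ V₁ > 0`
  set N : ℝ := ‖curlCLM‖ * (C / Q ^ 2) * (Q ^ 3 / 2 * E + 1 / (2 * Q ^ 3) * (8 * Q ^ 6 * V₁))
    with hN
  have hN0 : 0 ≤ N := by positivity
  have hdiv : I * ‖a‖ ≤ N + I * (2 * Q ^ 2 * D) := by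
    refine le_of_mul_le_mul_left ?_ ha0
    calc ‖a‖ * (I * ‖a‖) = I * ‖a‖ ^ 2 := by ring
      _ ≤ G₂ + I * (2 * Q ^ 2 * D * ‖a‖) := hmain
      _ = ‖a‖ * (N + I * (2 * Q ^ 2 * D)) := by rw [hG₂, hN]; ring
  have hsub : ‖a‖ - 2 * Q ^ 2 * D ≤ N / I := by
    rw [le_div_iff₀ hIpos]
    linarith
  have hNI : N / I ≤ N / (Q ^ 6 * V₁) := div_le_div_of_nonneg_left hN0 (by positivity) hIge
  have hfin : N / (Q ^ 6 * V₁) = ‖curlCLM‖ * C * (E / (2 * V₁) + 4) * (Q ^ 5)⁻¹ := by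
    rw [hN]
    field_simp
    ring
  linarith [hfin ▸ hNI]

/-! ## Time integrability of `(T - t)^{-a}`, `a < 1` -/

/-- `∫⁻_{(0,T)} (B (T − t)^{−a}) dt < ∞` for `a < 1` (`s ↦ s^{−a}` is interval-integrable at
`0` iff `−a > −1`, Mathlib `intervalIntegrable_rpow'`, composed with `t ↦ T − t`). [folklore] -/
theorem lintegral_Ioo_rpow_neg_lt_top {T a : ℝ} (B : ℝ) (ha : a < 1) :
    (∫⁻ t in Ioo 0 T, ENNReal.ofReal (B * (T - t) ^ (-a))) < ∞ := by
  have h1 : IntervalIntegrable (fun s : ℝ => s ^ (-a)) volume 0 T :=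
    intervalIntegral.intervalIntegrable_rpow' (by linarith)
  have h2 : IntervalIntegrable (fun t : ℝ => (T - t) ^ (-a)) volume T 0 := by
    simpa using h1.comp_sub_left T
  have h3 : IntegrableOn (fun t : ℝ => B * (T - t) ^ (-a)) (Ioo 0 T) volume :=
    (h2.symm.const_mul B).1.mono_set Ioo_subset_Ioc_self
  exact h3.lintegral_lt_top

/-! ## The energy bound in the BKM class on `[0, T)` -/

/-- Finite, non-increasing kinetic energy on `[0, T)` for a classical Euler solution in the BKM
class on every `[0, T'']`, `T'' < T`: `∫|u(t)|² ≤ ∫|u(0)|²` (the tree's energy inequality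
`IsClassicalNSSolutionOn.bkm_energy_le` on the slab `[0, t]`; Majda–Bertozzi 2002, Prop. 3.1).
[folklore] -/
theorem integrable_sq_norm_and_energy_le {T : ℝ}
    {u : ℝ → EuclideanSpace ℝ (Fin 3) → EuclideanSpace ℝ (Fin 3)}
    {p : ℝ → EuclideanSpace ℝ (Fin 3) → ℝ}
    (hsol : IsClassicalEulerSolutionOn (Ico 0 T) 0 u p)
    (hreg : ∀ T'' < T, HasBoundedSobolevNormsOn (Icc 0 T'') u) {t : ℝ} (ht : t ∈ Ico 0 T) :
    Integrable (fun x => ‖u t x‖ ^ 2) ∧ ∫ x, ‖u t x‖ ^ 2 ≤ ∫ x, ‖u 0 x‖ ^ 2 := by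
  have hB : HasBoundedSobolevNormsOn (Icc 0 t) u := hreg t ht.2
  have hu := fun τ (hτ : τ ∈ Icc 0 t) =>
    hsol.contDiff_velocity (⟨hτ.1, hτ.2.trans_lt ht.2⟩ : τ ∈ Ico 0 T)
  have htt : t ∈ Icc 0 t := ⟨ht.1, le_rfl⟩
  obtain ⟨⟨I₀, hI₀⟩, -⟩ := levelSq_bounds_of_hasBoundedSobolevNormsOn hu hB 0
  have hint : Integrable fun x => ‖u t x‖ ^ 2 :=
    (hI₀ t htt).1.congr (Eventually.of_forall fun x => levelSq_zero_eq_norm_sq (u t) x)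
  refine ⟨hint, ?_⟩
  rcases ht.1.eq_or_lt with h0 | h0
  · rw [← h0]
  · have hsol' : IsClassicalNSSolutionOn (Icc 0 t) 0 0 u p :=
      hsol.mono (Icc_subset_Ico_right ht.2) (uniqueDiffOn_Icc h0)
    exact hsol'.bkm_energy_le le_rfl h0 hB htt

end CIV2026

/-! ## The discharge -/

/-- **Constantin–Ignatova–Vicol 2026, Theorem 2.1, discharged** (arXiv:2602.17570, §2, Thm. 2.1,
p. 5: a finite-energy classical Euler solution on `[0, T)` in the Beale–Kato–Majda class that does
not continue in the class past `T` and has `sup_t (T − t)^{1+γ} ‖∇ω(t)‖_{L^∞} < ∞`, `γ > 0`,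
satisfies `γ ≥ 2/5`). If `γ < 2/5`, the two-scale bound `CIV2026.norm_curl_le_two_scale` at scale
`R = (T − t)^{2(1+γ)/7}`, fed with the rate hypothesis and the energy inequality
(`CIV2026.integrable_sq_norm_and_energy_le`), gives `‖ω(t)‖_{L^∞} ≤ K (T − t)^{−5(1+γ)/7}` with
`5(1+γ)/7 < 1`, so `∫₀ᵀ ‖ω‖_{L^∞} < ∞` (`CIV2026.lintegral_Ioo_rpow_neg_lt_top`) and the
discharged Beale–Kato–Majda criterion `beale_kato_majda_holds` continues the solution past `T` —
a contradiction. Source locator: arXiv:2602.17570, Theorem 2.1 (§2, p. 5) and its proof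
(pp. 5–6). [claim: ConstantinIgnatovaVicol2026Putative, status: under-review] -/
theorem CIV2026_collapseExponent_ge_two_fifths_holds :
    CIV2026_collapseExponent_ge_two_fifths := by
  intro T hT u p hsol hreg hblowup γ hγ hrate
  by_contra hlt
  push Not at hlt
  obtain ⟨M, hM⟩ := hrate
  obtain ⟨C, -, hC⟩ := exists_norm_fderiv_cutoff_le (E := EuclideanSpace ℝ (Fin 3))
  have hM0 : 0 ≤ M :=
    le_trans (mul_nonneg (Real.rpow_nonneg (by linarith) _) (norm_nonneg _))
      (hM 0 ⟨le_rfl, hT⟩ 0)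
  -- exponents: `a = 5(1+γ)/7 < 1`, `β = 2(1+γ)/7`
  set a : ℝ := 5 * (1 + γ) / 7 with ha
  set β : ℝ := 2 * (1 + γ) / 7 with hβ
  have ha1 : a < 1 := by rw [ha, div_lt_one (by norm_num)]; linarith
  set E₀ : ℝ := ∫ x, ‖u 0 x‖ ^ 2 with hE₀
  set K : ℝ := 2 * M +
    ‖curlCLM‖ * C * (E₀ / (2 * volume.real (closedBall (0 : EuclideanSpace ℝ (Fin 3)) 1)) + 4)
    with hK
  -- the pointwise bound `‖ω(t, x)‖ ≤ K (T - t)^{-a}` on `(0, T) × ℝ³`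
  have hbound : ∀ t ∈ Ioo 0 T, ∀ x, ‖curl (u t) x‖ ≤ K * (T - t) ^ (-a) := by
    intro t ht x
    have hτ : 0 < T - t := sub_pos.2 ht.2
    have ht' : t ∈ Ico 0 T := ⟨ht.1.le, ht.2⟩
    have hv : ContDiff ℝ 2 (u t) := (hsol.contDiff_velocity ht').of_le (by norm_cast)
    obtain ⟨hint, hEle⟩ := CIV2026.integrable_sq_norm_and_energy_le hsol hreg ht'
    have hD : ∀ y, ‖fderiv ℝ (curl (u t)) y‖ ≤ M / (T - t) ^ (1 + γ) := fun y => by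
      rw [le_div_iff₀ (Real.rpow_pos_of_pos hτ _), mul_comm]
      exact hM t ht' y
    have hRpos : 0 < (T - t) ^ β := Real.rpow_pos_of_pos hτ _
    have key := CIV2026.norm_curl_le_two_scale hv hD hint hEle hRpos (hC _ hRpos) x
    have e1 : 2 * (T - t) ^ β * (M / (T - t) ^ (1 + γ)) = 2 * M * (T - t) ^ (-a) := by
      rw [show 2 * (T - t) ^ β * (M / (T - t) ^ (1 + γ)) =
          2 * M * ((T - t) ^ β / (T - t) ^ (1 + γ)) by ring, ← Real.rpow_sub hτ]
      congr 2
      rw [ha, hβ]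
      ring
    have e2 : ((T - t) ^ β) ^ (-(5 / 2 : ℝ)) = (T - t) ^ (-a) := by
      rw [← Real.rpow_mul hτ.le]
      congr 1
      rw [ha, hβ]
      ring
    rw [e1, e2] at key
    calc ‖curl (u t) x‖ ≤ _ := key
      _ = K * (T - t) ^ (-a) := by rw [hK]; ring
  -- hence `∫₀ᵀ ‖ω(t)‖_{L^∞} dt < ∞`, and BKM continues the solution past `T`
  have hfin : (∫⁻ t in Ioo 0 T, ⨆ x, ‖curl (u t) x‖ₑ) < ∞ := by
    refine lt_of_le_of_lt (setLIntegral_mono' measurableSet_Ioo fun t ht => ?_)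
      (CIV2026.lintegral_Ioo_rpow_neg_lt_top K ha1)
    refine iSup_le fun x => ?_
    rw [← ofReal_norm]
    exact ENNReal.ofReal_le_ofReal (hbound t ht x)
  exact hblowup ((beale_kato_majda_holds le_rfl hT hsol hreg).2 hfin)

end Literature.Analysis.FluidPDE

end
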